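import Summits.QuantumFields.BalabanUV.T4Continuum.Spine.NE1p.DressedSmallFieldInnerLabelsRefinedWitnessLive
import Summits.QuantumFields.BalabanUV.T4Continuum.Spine.NE1p.DressedSmallFieldInnerLabelsRefinedMu

/-!
# T⁴ programme, spine estimate NE1′ (node O3b/H2) — WITNESS «THE SOURCE-PENCIL JUNCTION FIRES ON W71's TWO-TORUS DATUM»: this seat's S68
# `DressedSmallFieldInnerLabelsRefinedMu.muPart_locE_le_of_coresAt_pencil_innerLabels_refined` (N0x PART 2's inner-label μ-END on pv22's
# NESTED tori `(N, L·N)` with `foot := trefineDom L N`, `hmono` (S43.1) and the (2.27)-link (S66 §1 ∕ S40.1) ALL inside) APPLIED ONCE BY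
# NAME — a DECIDED applier — on W71's datum (`termsR` ∕ `GR` ∕ `actR`: ONE covered inner label on the REFINED unit block of the fine torus)
# read along the SOURCE pencil `s ↦ 0 + s • liveTable`; at every REAL source `0 < t ≤ 2` the μ-part is NOT zero

Cell `pub-balaban`, sub-cell `t4`, BINDER-OWNERS row NE1′; crew seat `b2b-balaban-t4-ne1p-formalise-leaf-07` (LEAF PROVER 07, generation
20); crew W-row **W109 ∕ DAG N29zzzzzza** (own-initiative WITNESS follower of this seat's S68 = DAG N29zzzzzt under R-T61 (ii) — W99
(`…InnerLabelsWitnessMu` ∕ `…OuterLabelsWitnessMu`, S66's decided appliers on W50's ∕ W52's one-torus data) is the pattern; INTENT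
`HOME/CLAIMS.log` l.25503, BOOKED typer gen 9 **R-T156** l.25520 (cap 240, KERNEL one slot at PROPOSED); cross-read **X258**).  ADDITIVE — imports W71 PART 2 `Spine/NE1p/DressedSmallFieldInnerLabelsRefinedWitnessLive`
(leaf-06 g12, DAG N29zzzz; → W71 PART 1 → S48, W50 PART 1, W59 `DressedSmallFieldNestedToriWitness`, S47's `TorusBlockRefinementCard`) and this
seat's S68 `Spine/NE1p/DressedSmallFieldInnerLabelsRefinedMu` (→ S66 → N0x PART 2, S40.1; → S43.1) ONLY; THEOREMS ONLY (0 `def`,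
0 `def … : Prop`, 0 cite, 0 sorry, 0 `attribute`; one closing `example`); nothing of W71 ∕ S68 ∕ S66 ∕ S48 ∕ S43 ∕ W50 ∕ W59 ∕ W45 ∕ W41 ∕ W35 ∕
W33 ∕ W24 ∕ pv22 is restated — `termsR`, `termsR_X₀`, `lab`, `blk`, `GR`, `GR_apply`, `actR`, `cR`, `cR_pos`, `majR`, `majR_pos`, `RR`, `sR`,
`sR_pos`, `sR_le_one`, `hRR_R`, `hκ_R`, `hadm_R`, `actR_X₀`, `norm_actR_X₀_lt_one`, `hmono_strict` (W71), `hsmall_N` (W59), `hrate_torus_num` ∕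
`exp_locE_cube` ∕ `X₀` (W24), `δF`∕`κF`∕`α₆F`∕`α₆F_pos`∕`h229_F` (W45), `letterMass_coreW` ∕ `cM` (W35), `N₁_coreW` ∕ `ctr0` ∕ `hroom0` ∕
`Acst` ∕ `liveTable` ∕ `integral_incr_pos` (W33), `budget_half` ∕ `closedForm_real_sub_zero` (W41), `torus_consts` (N0o), `K₀_four` (S24) are
used BY NAME.

WHY.  W71 fired S48 (N0u's inner-label END on the nested tori, the junction S40 × S43) for the ATTACHED part on ONE covered label living on
the refined block `trefineDom L N X₀` — and LOCATED that the junction's `hmono` is STRICT there for `3 ≤ L` (S47).  S68 is the owner's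
SOURCE-pencil twin of that junction (N0x PART 2's μ-END through S66 §1, with S43.1's refinement); this file is its decided applier:
* §1 the binders of S68 MET on W71's datum: **`hAmp_Rmu`** (amplitude at the radius `‖0‖ + μ₁‖liveTable‖`, `μ₁ ≤ 2`, constant `A := Acst∕2`,
  W41's `budget_half`; W71's majorant `majR l` IS the face's product), the located clauses BY NAME from W71 ∕ W59 ∕ W24 (`hκ_R`, `hRR_R`,
  `hadm_R`, `hrate_torus_num`) and two three-line `have`s (`h229` from W45's `h229_F`, `hsmall` = W59's `hsmall_N` re-lettered
  `0 + 2·(A∕4) = A∕2`); **`actR_real_sub_zero`** — the μ-increment at a REAL source `t`: `actR t X₀ − actR 0 X₀ = cR lab·∫ incr (t·r)`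
  (W71's `actR_X₀` + W41's `closedForm_real_sub_zero`);
* §2 **`refinedMuEnd_fires`** — S68 ONCE BY NAME (`h₀ := 0`, `v := liveTable`; every `N`, `L`), for `0 < μ₀ < μ₁ ≤ 2`, `‖μ‖ ≤ μ₀`;
  closed form **`refinedMuEnd_fires_closed`**: `≤ (K₀(64,8)∕2)·μ₀∕(μ₁ − μ₀)`;
* §3 GENUINE: **`actR_mu_live`** (`0 < t`: `cR lab > 0`, `∫ incr (t·r) > 0`) and **`refinedMuEnd_live`** (`0 < t ≤ 2`; W24's `exp_locE_cube`,
  W71's `norm_actR_X₀_lt_one`); the closing `example` puts the bound, the liveness at `t = 1` and W71's STRICT `hmono` (`3 ≤ L`) on one datum.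

WORDING OF RECORD: W71's — «(B3-amp) MET because the weight is CHOSEN as S48's majorant — UNPRINTED for Bałaban's cores (G-ne9p2-5); the
label, the block, `RR`, `sR`, `A∕4` are OURS over pv22's located letters; WHICH `(N, L·N)` is Bałaban's `(𝐃_{k+1}, 𝐃_k)` = pv22's READING
(D-pv22.3)» — now for the source pencil at `A∕2`; `μ₀`, `μ₁` symbolic with `μ₁ ≤ 2` (NE5's class radius), nothing about print's μ-window (w6);
the μ-extension is UNPRINTED (GAPS-T4 C-t4r2-340 (n1)∕(n2)).

HONEST FRAMING.  A DECIDED TOY ([folklore]; 0 sorry; 0 citations; no `def`).  The core is a THEOREM-backed instance of the cell's typed FORMAT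
of (2.14) over row NE5's TOY frame — NOT Bałaban's (2.14) terms; (B1b) NOT claimed; (B3-amp) MET by a CHOSEN weight — UNPRINTED for
Bałaban's cores (G-ne9p2-5); print's `4`∕`5`∕`17`, `L`, and the shapes of (2.27)∕(2.31)–(2.34)∕(2.36) ([Balaban1988RGII] = CMP 116 (1988)
pp. 17–19; [Balaban1987RGI] p. 251; [Dimock2013] §3 Lemma 10) are the imported modules' DISPLAYED print-shape, TYPE only — no numeral of
print is asserted as a fact about Bałaban's densities; 0 binders instantiated on Bałaban's densities; no wall item; the NE1′ wall wording of
record v1.8 (T4-DAG v48–v53) — words, not kind — does NOT move; R-t4r2-Q2 NOT met thereby; NE1′ ⇐ the named binders — NOT proved, NOT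
printed; spine PROVED 0∕9; count 9 unchanged.  ABSOLUTE RULE honoured.  Rung (B)+1 on ONE finite four-torus — NOT infinite volume, NOT a
mass gap, NOT OS on ℝ⁴, NOT Clay.  HONEST DEPENDENCY: continuum YM on T⁴ ⇐ BetaPertH ∧ nine spine estimates (0/9 proved); BetaPertH ⇐
(D1) ∧ (D4) ∧ CAP+tail; G-an2-4 gates asym, D1 and NE2/3/4.
-/

noncomputable section

namespace Summit.QuantumFields.BalabanUV.T4Continuum.NE1p.DressedSmallFieldInnerLabelsRefinedWitness

open Set Metric MeasureTheory Complex
open scoped BigOperators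
open Literature.MathematicalPhysics.QuantumFieldTheory.Balaban1983to89
open Literature.MathematicalPhysics.QuantumFieldTheory.Balaban1983to89.B12TreeDecay (K₀ K₀_pos)
open Literature.MathematicalPhysics.QuantumFieldTheory.Balaban1983to89.B13Resummation (locE)
open Literature.MathematicalPhysics.QuantumFieldTheory.Balaban1983to89.B13FamilySum (coveringFamilies)
open Literature.MathematicalPhysics.QuantumFieldTheory.Balaban1983to89.TreeLengthTorus (TPt TDom tsys torusTreeLen)
open Literature.MathematicalPhysics.QuantumFieldTheory.Balaban1983to89.TreeLengthTorusGeometry (tgeometry TTouch)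
open Summit.QuantumFields.BalabanUV.T4Continuum.B13HistMeasurable (B13HistM)
open Summit.QuantumFields.BalabanUV.T4Continuum.B13HistWitness (toyFrame)
open Summit.QuantumFields.BalabanUV.T4Continuum.TorusBlockRefinement (trefineDom)
open Summit.QuantumFields.BalabanUV.T4Continuum.NE1p.DressedSmallFieldTorusWitness (X₀ X₀_val hrate_torus_num exp_locE_cube)
open Summit.QuantumFields.BalabanUV.T4Continuum.NE1p.DressedSmallFieldGeometry (torus_consts)
open Summit.QuantumFields.BalabanUV.T4Continuum.NE1p.DressedSmallFieldGeometryFaces (K₀_four)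
open Summit.QuantumFields.BalabanUV.T4Continuum.NE1p.DressedSmallFieldCoresWitness (E1 crd liveTable norm_liveTable_le coreW N₁_coreW ctr0
  hroom0 Acst Acst_pos incr integral_incr_pos)
open Summit.QuantumFields.BalabanUV.T4Continuum.NE1p.DressedSmallFieldCoresMassWitness (letterMass_coreW cM)
open Summit.QuantumFields.BalabanUV.T4Continuum.NE1p.DressedSmallFieldDepCoresWitness (budget_half closedForm_real_sub_zero)
open Summit.QuantumFields.BalabanUV.T4Continuum.NE1p.DressedSmallFieldFamiliesWitness (δF κF α₆F α₆F_pos h229_F)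
open Summit.QuantumFields.BalabanUV.T4Continuum.NE1p.DressedSmallFieldNestedToriWitness (hsmall_N)
open Summit.QuantumFields.BalabanUV.T4Continuum.NE1p.DressedSmallFieldInnerLabelsRefinedMu (muPart_locE_le_of_coresAt_pencil_innerLabels_refined)

section Torus
variable (N : ℕ) [NeZero N] (L : ℕ) [NeZero L] (r : ℝ) (hr : 0 ≤ r)

/-! ## §1 The source-pencil amplitude clause at `A := A∕2` and the μ-increment at a real source -/

open Classical in
/-- **`hAmp` ALONG THE SOURCE PENCIL** (`h₀ = 0`, `v = liveTable`, `‖s‖ < μ₁ ≤ 2`, constant `A := Acst∕2`) [decided toy], in the LITERAL binder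
shape of S68 at NE5's toy letters `(mq, bq, N₀) = (1, 0, 1)`: `majR l·|cM r∕2|·√(2π)·e^{r·μ₁‖liveTable‖} ≤ (A∕2)·majR l` (W35 `letterMass_coreW`,
W33 `N₁_coreW`, W41 `budget_half` with `u = μ₁‖liveTable‖ ≤ 2`). [folklore] -/
theorem hAmp_Rmu {μ₁ : ℝ} (hμ₁ : μ₁ ≤ 2) (k : ℕ) :
    ∀ Z : (tsys 4 N).Dom, Z.1 ⊆ (X₀ N).1 → ∀ l ∈ termsR N L Z,
      (GR N L r hr k l k).lam.real univ *
          ((GR N L r hr k l k).wB * (fun (_ : ℕ) (_ : LabelR N L) (_ : ℕ) => (1 : ℝ)) k l k *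
            Real.exp ((fun (_ : ℕ) (_ : LabelR N L) (_ : ℕ) => (0 : ℝ)) k l k)) *
          (Real.pi / ((fun (_ : ℕ) (_ : LabelR N L) (_ : ℕ) => (1 : ℝ)) k l k / 2)) ^ (Module.finrank ℝ E1 / 2 : ℝ) *
        Real.exp ((GR N L r hr k l k).N₁ * (‖(0 : B13HistM toyFrame)‖ + μ₁ * ‖liveTable‖)) ≤
      Acst / 2 * ((∏ Y ∈ l.2.1, (α₆F * Real.exp (-(δF * κF * torusTreeLen Y.1)) *
        Real.exp (-(RR * (torusTreeLen Y.1 + 5))))) * (sR ^ 2 * 1) ^ l.2.2.card) := by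
  intro Z _ l _
  simp only [GR_apply]
  rw [letterMass_coreW, N₁_coreW, norm_zero, zero_add]
  have hp : 0 ≤ majR N L l := (majR_pos N L l).le
  have hT : μ₁ * ‖liveTable‖ ≤ 2 := (mul_le_mul hμ₁ norm_liveTable_le (norm_nonneg _) (by norm_num)).trans (by norm_num)
  have hb := budget_half r hr hT
  show |cR N L r l| * Real.sqrt (2 * Real.pi) * Real.exp (r * (μ₁ * ‖liveTable‖)) ≤ Acst / 2 * majR N L l
  unfold cR
  rw [abs_mul, abs_of_nonneg hp]
  calc |cM r / 2| * majR N L l * Real.sqrt (2 * Real.pi) * Real.exp (r * (μ₁ * ‖liveTable‖))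
      = majR N L l * (|cM r / 2| * Real.sqrt (2 * Real.pi) * Real.exp (r * (μ₁ * ‖liveTable‖))) := by ring
    _ ≤ majR N L l * (Acst / 2) := mul_le_mul_of_nonneg_left hb hp
    _ = Acst / 2 * majR N L l := by ring

/-- **THE μ-INCREMENT AT A REAL SOURCE**: `actR t X₀ − actR 0 X₀ = cR lab·∫ incr (t·r)` (W71's `actR_X₀`, W41's `closedForm_real_sub_zero`).
[folklore] -/
theorem actR_real_sub_zero (k : ℕ) (t : ℝ) :
    actR N L r hr k (t : ℂ) (X₀ N) - actR N L r hr k 0 (X₀ N) = ((cR N L r (lab N L) : ℝ) : ℂ) * ((∫ v, incr (t * r) v : ℝ) : ℂ) := by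
  rw [actR_X₀, actR_X₀]
  exact closedForm_real_sub_zero _ r hr t

/-! ## §2 THE SOURCE-PENCIL JUNCTION FIRES: S68 applied ONCE BY NAME (a decided applier) -/

open Classical in
/-- **S68's `muPart_locE_le_of_coresAt_pencil_innerLabels_refined` FIRES ON W71's DATUM** [decided toy]: the nested tori `(N, L·N)` (every `N`,
`L`), W71's cores `GR` indexed by inner labels of the REFINED footprints and its activity `actR` read along the SOURCE pencil (`h₀ := 0`,
`v := liveTable`, `‖s‖ < μ₁ ≤ 2`), `hAmp_Rmu` at `A := Acst∕2`, `(Rkp, r₁) := (2·(64 log 162)+2, 0)` with W24's `hrate_torus_num`, the «ε small»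
clause from W59's `hsmall_N` (`0 + 2·(A∕4) = A∕2`), bonds READ AS CUBES (`bondsOf := id`, `b₀ := 1`), `(δ, κ, α₆, R, s, t) := (δF, κF, α₆F,
RR, sR, 1)` with W71's `hκ_R` ∕ `hRR_R` and W45's `h229_F` (inline), W71's `hadm_R`, W33's `ctr0`∕`hroom0`, NE5's toy letters INLINE; NO footprint
map, NO `hmono`, NO link binder, NO geometry hypothesis (all inside S68); for `0 < μ₀ < μ₁`, `‖μ‖ ≤ μ₀`.  Conclusion LITERAL. [folklore] -/
theorem refinedMuEnd_fires {μ₁ μ₀ : ℝ} {μ : ℂ} (hμ₁ : μ₁ ≤ 2) (h0 : 0 < μ₀) (h01 : μ₀ < μ₁) (hμ : ‖μ‖ ≤ μ₀) (k : ℕ) :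
    ‖locE (TTouch (d := 4) (N := N)) (fun Z : (tsys 4 N).Dom => Z.1) (actR N L r hr k μ) (X₀ N).1 -
        locE (TTouch (d := 4) (N := N)) (fun Z : (tsys 4 N).Dom => Z.1) (actR N L r hr k 0) (X₀ N).1‖ ≤
      Real.exp 1 * 9 * 64 * K₀ 64 8 ^ 2 * (Acst / 2) * Real.exp (-(0 * torusTreeLen (X₀ N).1)) * (μ₀ / (μ₁ - μ₀)) := by
  have h229 : Real.exp 1 * K₀ 64 8 * 64 * α₆F ≤ 1 := by have h := h229_F 1; rw [(torus_consts 1).2.2, K₀_four] at h; exact h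
  have hsmall : Acst / 2 * Real.exp (5 * 0 + 1) * K₀ 64 8 * 9 * 64 ≤ 1 := by
    have h := hsmall_N
    calc Acst / 2 * Real.exp (5 * 0 + 1) * K₀ 64 8 * 9 * 64 = (0 + 2 * (Acst / 4)) * Real.exp (5 * 0 + 1) * K₀ 64 8 * 9 * 64 := by
          ring
      _ ≤ 1 := h
  exact muPart_locE_le_of_coresAt_pencil_innerLabels_refined (N := N) (L := L) (GR N L r hr)
    (Win := Set.univ) (ctr := ctr0) (ROp := fun _ => 1) (RHist := fun _ => 2) (R' := fun _ => 2)
    (mq := fun _ _ _ => 1) (bq := fun _ _ _ => 0) (N₀ := fun _ _ _ => 1)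
    hroom0 (fun _ _ _ _ _ _ _ => one_pos)
    (fun _ _ _ _ _ _ _ => ⟨fun _ _ => aestronglyMeasurable_const, fun _ => differentiableOn_const _, fun _ _ _ => by
      show ‖(1 : ℂ)‖ ≤ 1; rw [norm_one]⟩)
    (fun _ _ _ _ _ _ _ => ⟨fun _ _ => (Complex.measurable_ofReal.comp (measurable_snd.norm.pow_const 2)).aestronglyMeasurable,
      fun _ _ => differentiableOn_const _, fun _ _ _ v => by
        show 1 * ‖v‖ ^ 2 - 0 ≤ (((‖v‖ ^ 2 : ℝ) : ℂ)).re; rw [Complex.ofReal_re]; simp⟩)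
    (g := fun _ => 0) (Set.mem_univ _) (U := ()) (o := 0) (h₀ := 0) (v := liveTable) (μ₁ := μ₁)
    (by show ‖(0 : ℂ) - 0‖ ≤ 1; simp)
    (by show ‖(0 : B13HistM toyFrame) - 0‖ + μ₁ * ‖liveTable‖ ≤ 2; rw [sub_zero, norm_zero, zero_add];
        exact (mul_le_mul hμ₁ norm_liveTable_le (norm_nonneg _) (by norm_num)).trans (by norm_num))
    (emb := fun _ => k) (fun _ => rfl) (terms := termsR N L) (act := actR N L r hr k) (fun _ _ _ => rfl)
    (A := Acst / 2) (Rkp := 2 * (64 * Real.log 162) + 2) (r₁ := 0) (X₀ N) (sμ := μ)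
    (by have := Acst_pos; positivity) le_rfl hrate_torus_num hsmall
    (fun W => W) (δ := δF) (κ := κF) (α₆ := α₆F) (R := RR) (b₀ := 1) (s := sR) (t := 1) α₆F_pos.le hκ_R h229
    sR_pos.le sR_le_one zero_le_one (fun W => by rw [one_mul]) hRR_R (hadm_R N L) (hAmp_Rmu N L r hr hμ₁ k) h0 h01 hμ

open Classical in
/-- … in CLOSED FORM: the μ-part is `≤ (K₀(64,8)∕2)·μ₀∕(μ₁ − μ₀)`. [folklore] -/
theorem refinedMuEnd_fires_closed {μ₁ μ₀ : ℝ} {μ : ℂ} (hμ₁ : μ₁ ≤ 2) (h0 : 0 < μ₀) (h01 : μ₀ < μ₁) (hμ : ‖μ‖ ≤ μ₀) (k : ℕ) :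
    ‖locE (TTouch (d := 4) (N := N)) (fun Z : (tsys 4 N).Dom => Z.1) (actR N L r hr k μ) (X₀ N).1 -
        locE (TTouch (d := 4) (N := N)) (fun Z : (tsys 4 N).Dom => Z.1) (actR N L r hr k 0) (X₀ N).1‖ ≤
      K₀ 64 8 / 2 * (μ₀ / (μ₁ - μ₀)) := by
  refine (refinedMuEnd_fires N L r hr hμ₁ h0 h01 hμ k).trans (le_of_eq ?_)
  rw [zero_mul, neg_zero, Real.exp_zero, mul_one]
  unfold Acst
  have hK := K₀_pos (64 : ℝ) 8
  have he := Real.exp_pos 1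
  field_simp

/-! ## §3 GENUINE: the μ-part of the activity at a REAL positive source is NOT zero -/

/-- **THE μ-PART AT A REAL POSITIVE SOURCE IS NOT ZERO** [decided toy] (`cR lab > 0`, W33's `∫ incr (t·r) > 0` for `0 < t`, `0 < r`).
[folklore] -/
theorem actR_mu_live (hr0 : 0 < r) {t : ℝ} (ht : 0 < t) (k : ℕ) : actR N L r hr k (t : ℂ) (X₀ N) ≠ actR N L r hr k 0 (X₀ N) := by
  intro h
  have h0 := sub_eq_zero.2 h
  rw [actR_real_sub_zero] at h0
  rcases mul_eq_zero.1 h0 with hc | hI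
  · exact (cR_pos N L r (lab N L)).ne' (by exact_mod_cast hc)
  · exact (integral_incr_pos (t * r) (mul_pos ht hr0)).ne' (by exact_mod_cast hI)

open Classical in
/-- **THE μ-END's BOUNDED QUANTITY IS NOT ZERO** for a REAL source `0 < t ≤ 2` [decided toy]: equal dressed outputs on the coarse cube would
give equal activities at `X₀` (W24's `exp_locE_cube` BY NAME; W71's `norm_actR_X₀_lt_one` for `‖t‖ ≤ 2`), contradicting `actR_mu_live`.
[folklore] -/
theorem refinedMuEnd_live (hr0 : 0 < r) {t : ℝ} (ht : 0 < t) (ht2 : t ≤ 2) (k : ℕ) :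
    locE (TTouch (d := 4) (N := N)) (fun Z : (tsys 4 N).Dom => Z.1) (actR N L r hr k (t : ℂ)) (X₀ N).1 ≠
      locE (TTouch (d := 4) (N := N)) (fun Z : (tsys 4 N).Dom => Z.1) (actR N L r hr k 0) (X₀ N).1 := by
  intro h
  have ht' : ‖(t : ℂ)‖ ≤ 2 := by rw [Complex.norm_real, Real.norm_eq_abs, abs_of_pos ht]; exact ht2
  have h1 := exp_locE_cube N (w := actR N L r hr k (t : ℂ)) (norm_actR_X₀_lt_one N L r hr k ht')
  have h0 := exp_locE_cube N (w := actR N L r hr k 0) (norm_actR_X₀_lt_one N L r hr k (by simp))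
  rw [X₀_val] at h
  have h' := congrArg cexp h
  rw [h1, h0, add_right_inj] at h'
  exact actR_mu_live N L r hr hr0 ht k h'

open Classical in
/-- **ON ONE STRICTLY-REFINED DATUM** (`3 ≤ L`): S68's μ-bound, its liveness at the real source `t = 1` (W71's `actR_live` instance), and
W71's STRICT `hmono` — the junction's footprint map costs tree length on the very datum the μ-END fires on. [folklore] -/
example (hL : 3 ≤ L) (hr0 : 0 < r) (k : ℕ) :
    ‖locE (TTouch (d := 4) (N := N)) (fun Z : (tsys 4 N).Dom => Z.1) (actR N L r hr k ((1 : ℝ) : ℂ)) (X₀ N).1 -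
          locE (TTouch (d := 4) (N := N)) (fun Z : (tsys 4 N).Dom => Z.1) (actR N L r hr k 0) (X₀ N).1‖ ≤ K₀ 64 8 / 2 * (1 / (2 - 1)) ∧
      locE (TTouch (d := 4) (N := N)) (fun Z : (tsys 4 N).Dom => Z.1) (actR N L r hr k ((1 : ℝ) : ℂ)) (X₀ N).1 ≠
        locE (TTouch (d := 4) (N := N)) (fun Z : (tsys 4 N).Dom => Z.1) (actR N L r hr k 0) (X₀ N).1 ∧
      torusTreeLen (X₀ N).1 < torusTreeLen (blk N L).1 :=
  ⟨refinedMuEnd_fires_closed N L r hr (μ₁ := 2) (μ₀ := 1) le_rfl one_pos (by norm_num) (by simp) k,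
    refinedMuEnd_live N L r hr hr0 one_pos (by norm_num) k, hmono_strict N L hL⟩

end Torus

end Summit.QuantumFields.BalabanUV.T4Continuum.NE1p.DressedSmallFieldInnerLabelsRefinedWitness

end
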